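import Summits.QuantumFields.YangMills.Theorems.LuscherReductionTwistedTraceScalingBTProfileEnvelopes
import HarnessLib

/-!
# (B-T) FOR AN ARBITRARY PROFILE, part 2: the rates on SCHEDULE B (`r ≤ β^{-1/2}ℓ`, `α = β^{-1/2}ℓ²`, `R₁ = 5β^{-1/2}ℓ²`)
# (lane A of S-BASE, crux `TwistedTraceScaling` stmt-QuantumFields-20203, C4-CORE, the (B-T) pen; design note `pub/ym-fleet/ym-luscher-20007-p1/COARSE-DESIGN.md` §26)

Schedule B lets the fibre profile live out to radius `β^{-1/2}·log β` (so that a truncated frozen stiff Gaussian qualifies); the price is log powers in every rate.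
The algebraic envelopes under `βR² ≤ ℓ²` are in `…BTProfileEnvelopes`; here: §2 the schedule-B facts (`eventually_scheduleB_facts`, with `ℓ² ` in the role of `ℓ`); §3 ★ `eventually_coreEps1_le_B` (`≤ Kβ^{-s}ℓ⁴`),
★ `eventually_coreEps2_le_B`, ★ `eventually_coreEta_le_B` (`≤ K(β^{-2s}+β^{-1/2})ℓ⁸`), `tendsto_btW8`, ★★ `eventually_coreEps_sum_le_one_B`; §4 ★★ `eventually_btKappa_le_B`
(`κ ≤ β^{-2s}ℓ⁹`, `s ≤ 1/4`) and the rate fields for `κ_B = 2β^{-2s}ℓ⁹`: `rateB_nonneg`, `rateB_ge` (`btKappa + β^{-1} ≤ κ_B`), `rateB_dom`, `rateB_small` (`1/6 < s ≤ 1/4`);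
§5 `eventually_radius_small_B` (hr_small for any `r ≤ β^{-1/2}ℓ`).  The radius `r` is a free function with `0 ≤ r β ≤ β^{-1/2}ℓ`.
HONEST FRAMING: a stub of a child of the CONDITIONAL reduction route R2b1; C4-CORE OPEN ((B-ST), (B-OD)); not infinite volume, not a gap, not Clay.
-/

set_option autoImplicit false

noncomputable section

open MeasureTheory Filter Topology Real Asymptotics
open scoped BigOperators
open Literature.MathematicalPhysics.QuantumFieldTheory
open Literature.MathematicalPhysics.QuantumLattice

namespace Summit.QuantumFields.YangMills.Theorems.FemtoTransferGap.TwoLattice.ConstTube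

open Summit.QuantumFields.YangMills.Theorems.FemtoTransferGap
open Summit.QuantumFields.YangMills.Theorems.FemtoTransferGap.TwoLattice
open Summit.QuantumFields.YangMills.Theorems.FemtoTransferGap.TwoLattice.Cov

variable {L : ℕ} [NeZero L]

/-! ## §2 Schedule B satisfies the hypotheses of §1, eventually (with `ℓ²` in the role of `ℓ`) -/

/-- Eventually along schedule B (`r ≤ xℓ`, `α = xℓ²`, `R₁ = 5xℓ²`, `T = 9L R₁ + ε`, `x = β^{-1/2}`, `p = β^{-s}`, `ℓ = log β`): the hypotheses of the envelopes of §1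
with `ℓ² ` in the role of `ℓ`. [folklore] -/
theorem eventually_scheduleB_facts {s : ℝ} (hs : 0 < s) (hs2 : s < 1 / 2) {r : ℝ → ℝ} (hr : ∀ β, 0 ≤ r β ∧ r β ≤ powScale (1 / 2) β * btLog β) :
    ∀ᶠ β : ℝ in atTop, 1 ≤ β ∧ btLog β = Real.log β ∧ 1 ≤ btLog β ^ 2 ∧
      0 ≤ recordDelta1 L s β ∧ recordDelta1 L s β ≤ 14 * powScale s β ∧ recordDelta1 L s β ≤ 1 ∧
      0 ≤ powScale (1 / 2) β ∧ powScale (1 / 2) β ≤ 1 ∧ powScale s β ^ 2 = powScale (2 * s) β ∧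
      0 ≤ 9 * L * (5 * (powScale (1 / 2) β * btLog β ^ 2)) + btEps β ∧ 9 * L * (5 * (powScale (1 / 2) β * btLog β ^ 2)) + btEps β ≤ 1 ∧
      9 * L * (5 * (powScale (1 / 2) β * btLog β ^ 2)) + btEps β ≤ 46 * L * powScale (1 / 2) β * btLog β ^ 2 ∧
      β * (9 * L * (5 * (powScale (1 / 2) β * btLog β ^ 2)) + btEps β) ^ 2 ≤ 2116 * (L : ℝ) ^ 2 * (btLog β ^ 2) ^ 2 ∧ β * r β ^ 2 ≤ (btLog β ^ 2) ^ 2 ∧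
      0 ≤ (L : ℝ) ^ 3 * (12 * recordDelta1 L s β ^ 4) ∧
      (L : ℝ) ^ 3 * (12 * recordDelta1 L s β ^ 4) ≤ 12 * (L : ℝ) ^ 3 * recordDelta1 L s β ^ 2 ∧
      Real.sqrt ((L : ℝ) ^ 3 * (12 * recordDelta1 L s β ^ 4)) ≤ 4 * (L : ℝ) ^ 2 * recordDelta1 L s β ^ 2 ∧
      β * (btEps β * Fintype.card (Site 3 L)) = (Fintype.card (Site 3 L) : ℝ) ∧ powScale (1 / 2) β * btLog β ^ 2 ≤ 1 := by
  have hL1 : (1 : ℝ) ≤ L := by exact_mod_cast NeZero.one_le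
  have hL0 : (0 : ℝ) < L := by linarith
  have hN1 : (1 : ℝ) ≤ Fintype.card (Site 3 L) := by exact_mod_cast Fintype.card_pos
  have hN : (0 : ℝ) < Fintype.card (Site 3 L) := by linarith
  have t46 := (tendsto_powScale_mul_btLog_pow (show (0 : ℝ) < 1 / 2 by norm_num) 2).const_mul (46 * (L : ℝ))
  rw [mul_zero] at t46
  filter_upwards [eventually_schedule_facts (L := L) hs hs2, t46.eventually (eventually_le_nhds one_pos)] with β hf h46
  obtain ⟨hβ1, hℓeq, -, -, hεx, -, -, -, hδs, -, hδhalf⟩ := hf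
  set x := powScale (1 / 2) β with hxdef
  set δ := recordDelta1 L s β with hδdef
  set ℓ := btLog β with hℓdef
  have hx0 : 0 < x := powScale_pos _ _
  have hx1 : x ≤ 1 := powScale_le_one (by norm_num) β
  have hℓ1 : 1 ≤ ℓ := one_le_btLog β
  have hℓ0 : 0 ≤ ℓ := by linarith
  have hl2 : (1 : ℝ) ≤ ℓ ^ 2 := one_le_pow₀ hℓ1
  have hl12 : ℓ ≤ ℓ ^ 2 := le_self_pow₀ hℓ1 (by norm_num)
  have hp0 : 0 < powScale s β := powScale_pos _ _
  have hδ0 : 0 ≤ δ := by rw [hδdef]; unfold recordDelta1; positivity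
  have hδp : δ ≤ 14 * powScale s β := by
    rw [hδdef]; unfold recordDelta1; rw [div_le_iff₀ hN]; nlinarith
  have hδ1 : δ ≤ 1 := by linarith
  have hε0 : 0 < btEps β := powScale_pos _ _
  have hp2 : powScale s β ^ 2 = powScale (2 * s) β := by
    have hβ0 : 0 ≤ β := by linarith
    rw [powScale_eq hβ1, powScale_eq hβ1, ← Real.rpow_mul_natCast hβ0]; congr 1; push_cast; ring
  have hT0 : 0 ≤ 9 * L * (5 * (x * ℓ ^ 2)) + btEps β := by positivity
  have hTx : 9 * L * (5 * (x * ℓ ^ 2)) + btEps β ≤ 46 * L * x * ℓ ^ 2 := by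
    have h1 : btEps β ≤ x * ℓ ^ 2 := hεx.trans (le_mul_of_one_le_right hx0.le hl2)
    have h2 : x * ℓ ^ 2 ≤ L * (x * ℓ ^ 2) := le_mul_of_one_le_left (by positivity) hL1
    nlinarith
  have hβx : β * x ^ 2 = 1 := mul_powScale_half_sq hβ1
  have hT2 : β * (9 * L * (5 * (x * ℓ ^ 2)) + btEps β) ^ 2 ≤ 2116 * (L : ℝ) ^ 2 * (ℓ ^ 2) ^ 2 := by
    have h := pow_le_pow_left₀ hT0 hTx 2
    calc β * (9 * L * (5 * (x * ℓ ^ 2)) + btEps β) ^ 2 ≤ β * (46 * L * x * ℓ ^ 2) ^ 2 := mul_le_mul_of_nonneg_left h (by linarith)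
      _ = 2116 * (L : ℝ) ^ 2 * (ℓ ^ 2) ^ 2 * (β * x ^ 2) := by ring
      _ = 2116 * (L : ℝ) ^ 2 * (ℓ ^ 2) ^ 2 := by rw [hβx, mul_one]
  have hβR : β * r β ^ 2 ≤ (ℓ ^ 2) ^ 2 := by
    have h := pow_le_pow_left₀ (hr β).1 (hr β).2 2
    calc β * r β ^ 2 ≤ β * (x * ℓ) ^ 2 := mul_le_mul_of_nonneg_left h (by linarith)
      _ = ℓ ^ 2 * (β * x ^ 2) := by ring
      _ = ℓ ^ 2 := by rw [hβx, mul_one]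
      _ ≤ (ℓ ^ 2) ^ 2 := le_self_pow₀ hl2 (by norm_num)
  have hσ0 : 0 ≤ (L : ℝ) ^ 3 * (12 * δ ^ 4) := by positivity
  have hσδ : (L : ℝ) ^ 3 * (12 * δ ^ 4) ≤ 12 * (L : ℝ) ^ 3 * δ ^ 2 := by
    have h4 : δ ^ 4 ≤ δ ^ 2 := pow_le_pow_of_le_one hδ0 hδ1 (show 2 ≤ 4 by norm_num)
    calc (L : ℝ) ^ 3 * (12 * δ ^ 4) = 12 * (L : ℝ) ^ 3 * δ ^ 4 := by ring
      _ ≤ 12 * (L : ℝ) ^ 3 * δ ^ 2 := by gcongr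
  have hsσ : Real.sqrt ((L : ℝ) ^ 3 * (12 * δ ^ 4)) ≤ 4 * (L : ℝ) ^ 2 * δ ^ 2 := by
    rw [Real.sqrt_le_left (by positivity)]
    have hL34 : (L : ℝ) ^ 3 ≤ (L : ℝ) ^ 4 := pow_le_pow_right₀ hL1 (by norm_num)
    have hδ4 : 0 ≤ δ ^ 4 := by positivity
    calc (L : ℝ) ^ 3 * (12 * δ ^ 4) ≤ (L : ℝ) ^ 4 * (16 * δ ^ 4) := mul_le_mul hL34 (by nlinarith) (by positivity) (by positivity)
      _ = (4 * (L : ℝ) ^ 2 * δ ^ 2) ^ 2 := by ring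
  have hΓ : β * (btEps β * Fintype.card (Site 3 L)) = (Fintype.card (Site 3 L) : ℝ) := by
    rw [← mul_assoc, show btEps β = powScale 1 β from rfl, mul_powScale_one hβ1, one_mul]
  have hα1 : x * ℓ ^ 2 ≤ 1 := by
    have : x * ℓ ^ 2 ≤ 46 * L * (x * ℓ ^ 2) := le_mul_of_one_le_left (by positivity) (by nlinarith)
    linarith
  have hT1 : 9 * L * (5 * (x * ℓ ^ 2)) + btEps β ≤ 1 := hTx.trans (by linarith)
  exact ⟨hβ1, hℓeq, hl2, hδ0, hδp, hδ1, hx0.le, hx1, hp2, hT0, hT1, hTx, hT2, hβR, hσ0, hσδ, hsσ, hΓ, hα1⟩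

/-! ## §3 ★ The rates along schedule B -/

/-- ★ `ε₁ ≤ K·β^{-s}ℓ⁴` eventually on schedule B. [folklore] -/
theorem eventually_coreEps1_le_B {s : ℝ} (hs : 0 < s) (hs2 : s < 1 / 2) {r : ℝ → ℝ} (hr : ∀ β, 0 ≤ r β ∧ r β ≤ powScale (1 / 2) β * btLog β) :
    ∃ K : ℝ, 0 ≤ K ∧ ∀ᶠ β : ℝ in atTop,
      coreEps1 L β (recordDelta1 L s β) (9 * L * (5 * (powScale (1 / 2) β * btLog β ^ 2)) + btEps β) (r β) ≤ K * (powScale s β * btLog β ^ 4) := by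
  refine ⟨14 * (288 * (Fintype.card (Edge 3 L) : ℝ) * (2116 * (L : ℝ) ^ 2) + 160 * (Fintype.card (Plaquette 3 L × Fin 3) : ℝ)), by positivity, ?_⟩
  filter_upwards [eventually_scheduleB_facts (L := L) hs hs2 hr] with β h
  obtain ⟨hβ1, -, -, hδ0, hδp, -, -, -, -, -, -, -, hT2, hβR, -⟩ := h
  have h := coreEps1_le_atom' (L := L) (by linarith) hδ0 hδp hT2 hβR
  have e : (btLog β ^ 2) ^ 2 = btLog β ^ 4 := by ring
  rw [e] at h; exact h

/-- ★ `ε₂ ≤ K·(β^{-2s} + β^{-1/2})ℓ⁸` eventually on schedule B. [folklore] -/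
theorem eventually_coreEps2_le_B {s : ℝ} (hs : 0 < s) (hs2 : s < 1 / 2) {r : ℝ → ℝ} (hr : ∀ β, 0 ≤ r β ∧ r β ≤ powScale (1 / 2) β * btLog β) :
    ∃ K : ℝ, 0 ≤ K ∧ ∀ᶠ β : ℝ in atTop,
      coreEps2 L β (recordDelta1 L s β) (9 * L * (5 * (powScale (1 / 2) β * btLog β ^ 2)) + btEps β) (r β) ((L : ℝ) ^ 3 * (12 * recordDelta1 L s β ^ 4)) ≤
        K * ((powScale (2 * s) β + powScale (1 / 2) β) * btLog β ^ 8) := by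
  set A : ℝ := 2116 * (L : ℝ) ^ 2 with hA
  have hA0 : 0 ≤ A := by rw [hA]; positivity
  refine ⟨576 * 196 * (Fintype.card (Edge 3 L) : ℝ) * A + 50 * (12 * 196 * (L : ℝ) ^ 3) * (Fintype.card (Plaquette 3 L × Fin 3) : ℝ) +
      (Fintype.card (Plaquette 3 L) : ℝ) * (1728 * (4 * 196 * A * (L : ℝ) ^ 2) + 29376 * (46 * A * L) + 700569 * (2116 * A * (L : ℝ) ^ 2)) +
      (Fintype.card (Plaquette 3 L) : ℝ) * (29376 * (46 * A * L) + 700569 * (2116 * A * (L : ℝ) ^ 2)) +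
      145000000 * 196 * (Fintype.card (Plaquette 3 L × Fin 3) : ℝ), by positivity, ?_⟩
  filter_upwards [eventually_scheduleB_facts (L := L) hs hs2 hr] with β h
  obtain ⟨hβ1, -, hl2, hδ0, hδp, -, hx0, hx1, hp2, hT0, -, hTx, hT2, hβR, -, hσδ, hsσ, -⟩ := h
  have h := coreEps2_le_atom' (L := L) (by linarith) hδ0 hδp hl2 hx0 hx1 hT0 hTx hT2 hA0 hβR hσδ hsσ
  have e : (btLog β ^ 2) ^ 4 = btLog β ^ 8 := by ring
  rw [hp2, e] at h
  exact h

/-- ★ `η ≤ K·(β^{-2s} + β^{-1/2})ℓ⁸` eventually on schedule B. [folklore] -/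
theorem eventually_coreEta_le_B {s : ℝ} (hs : 0 < s) (hs2 : s < 1 / 2) {r : ℝ → ℝ} (hr : ∀ β, 0 ≤ r β ∧ r β ≤ powScale (1 / 2) β * btLog β) :
    ∃ K : ℝ, 0 ≤ K ∧ ∀ᶠ β : ℝ in atTop,
      coreEta L β (recordDelta1 L s β) (powScale (1 / 2) β * btLog β ^ 2) (9 * L * (5 * (powScale (1 / 2) β * btLog β ^ 2)) + btEps β) (r β)
          (btEps β * Fintype.card (Site 3 L)) ((L : ℝ) ^ 3 * (12 * recordDelta1 L s β ^ 4)) ≤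
        K * ((powScale (2 * s) β + powScale (1 / 2) β) * btLog β ^ 8) := by
  set A : ℝ := 2116 * (L : ℝ) ^ 2 with hA
  have hA0 : 0 ≤ A := by rw [hA]; positivity
  set N : ℝ := (Fintype.card (Site 3 L) : ℝ) with hNdef
  have hN0 : 0 ≤ N := Nat.cast_nonneg _
  refine ⟨(Fintype.card (Edge 3 L) : ℝ) * (558 * A + 192 * A) + 216 * N + 50 * (Fintype.card (Plaquette 3 L × Fin 3) : ℝ) * (12 * 196 * (L : ℝ) ^ 3) +
      (Fintype.card (Plaquette 3 L) : ℝ) * (1728 * (4 * 196 * A * (L : ℝ) ^ 2) + 29376 * (46 * A * L) + 700569 * (2116 * A * (L : ℝ) ^ 2)) +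
      5040 * (Fintype.card (Plaquette 3 L × Fin 3) : ℝ), by positivity, ?_⟩
  filter_upwards [eventually_scheduleB_facts (L := L) hs hs2 hr] with β h
  obtain ⟨hβ1, -, hl2, hδ0, hδp, hδ1, hx0, hx1, hp2, hT0, -, hTx, hT2, hβR, -, hσδ, hsσ, hΓ, -⟩ := h
  have hβ0 : 0 ≤ β := by linarith
  have h := coreEta_le_atom' (L := L) (N := N) hβ0 hδ0 hδp hδ1 hl2 hx0 hx1 hT0 hTx hT2 hA0 hβR hσδ hsσ (by positivity) le_rfl
    (mul_nonneg (btEps_pos_le β).1.le (Nat.cast_nonneg _)) hΓ.le hN0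
  have e : (btLog β ^ 2) ^ 4 = btLog β ^ 8 := by ring
  rw [hp2, e] at h
  exact h

omit [NeZero L] in
/-- The atom `(β^{-2s} + β^{-1/2})ℓ⁸ → 0`. [folklore] -/
theorem tendsto_btW8 {s : ℝ} (hs : 0 < s) : Tendsto (fun β : ℝ => (powScale (2 * s) β + powScale (1 / 2) β) * btLog β ^ 8) atTop (𝓝 0) := by
  have h := (tendsto_powScale_mul_btLog_pow (show (0 : ℝ) < 2 * s by linarith) 8).add (tendsto_powScale_mul_btLog_pow (show (0 : ℝ) < 1 / 2 by norm_num) 8)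
  rw [add_zero] at h
  exact h.congr' (Eventually.of_forall fun β => by ring)

/-- ★★ **`ε₁ + ε₂ ≤ 1` eventually on schedule B.** [folklore] -/
theorem eventually_coreEps_sum_le_one_B {s : ℝ} (hs : 0 < s) (hs2 : s < 1 / 2) {r : ℝ → ℝ} (hr : ∀ β, 0 ≤ r β ∧ r β ≤ powScale (1 / 2) β * btLog β) :
    ∀ᶠ β : ℝ in atTop,
      coreEps1 L β (recordDelta1 L s β) (9 * L * (5 * (powScale (1 / 2) β * btLog β ^ 2)) + btEps β) (r β) +
          coreEps2 L β (recordDelta1 L s β) (9 * L * (5 * (powScale (1 / 2) β * btLog β ^ 2)) + btEps β) (r β)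
            ((L : ℝ) ^ 3 * (12 * recordDelta1 L s β ^ 4)) ≤ 1 := by
  obtain ⟨K₁, hK₁, h₁⟩ := eventually_coreEps1_le_B (L := L) hs hs2 hr
  obtain ⟨K₂, hK₂, h₂⟩ := eventually_coreEps2_le_B (L := L) hs hs2 hr
  have t₁ := (tendsto_powScale_mul_btLog_pow hs 4).const_mul K₁
  have t₂ := (tendsto_btW8 hs).const_mul K₂
  rw [mul_zero] at t₁ t₂
  filter_upwards [h₁, h₂, t₁.eventually (eventually_le_nhds (show (0 : ℝ) < 1 / 2 by norm_num)),
    t₂.eventually (eventually_le_nhds (show (0 : ℝ) < 1 / 2 by norm_num))] with β e₁ e₂ s₁ s₂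
  linarith

/-! ## §4 ★★ `κ ≤ β^{-2s}ℓ⁹` on schedule B, and the record rate `κ_B = 2β^{-2s}ℓ⁹` -/
/-- ★★ **`κ(schedule B) ≤ β^{-2s}·ℓ⁹` eventually** (`0 < s ≤ 1/4`). [folklore] -/
theorem eventually_btKappa_le_B {s : ℝ} (hs : 0 < s) (hs4 : s ≤ 1 / 4) {r : ℝ → ℝ} (hr : ∀ β, 0 ≤ r β ∧ r β ≤ powScale (1 / 2) β * btLog β) :
    ∀ᶠ β : ℝ in atTop,
      btKappa L β (recordDelta1 L s β) (powScale (1 / 2) β * btLog β ^ 2) (9 * L * (5 * (powScale (1 / 2) β * btLog β ^ 2)) + btEps β) (r β)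
          (btEps β * Fintype.card (Site 3 L)) ((L : ℝ) ^ 3 * (12 * recordDelta1 L s β ^ 4)) ≤ powScale (2 * s) β * btLog β ^ 9 := by
  have hs2 : s < 1 / 2 := by linarith
  obtain ⟨K₁, hK₁, h₁⟩ := eventually_coreEps1_le_B (L := L) hs hs2 hr
  obtain ⟨K₂, hK₂, h₂⟩ := eventually_coreEps2_le_B (L := L) hs hs2 hr
  obtain ⟨K₃, hK₃, h₃⟩ := eventually_coreEta_le_B (L := L) hs hs2 hr
  set K : ℝ := 3 * K₃ + 4 * K₂ + 6 * K₁ ^ 2 + 6 * K₂ ^ 2 with hKdef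
  have hK0 : 0 ≤ K := by rw [hKdef]; positivity
  have tW := tendsto_btW8 hs
  have t₂ := tW.const_mul K₂
  have t₃ := tW.const_mul K₃
  rw [mul_zero] at t₂ t₃
  filter_upwards [h₁, h₂, h₃, eventually_scheduleB_facts (L := L) hs hs2 hr, tW.eventually (eventually_le_nhds one_pos),
    t₂.eventually (eventually_le_nhds one_pos), t₃.eventually (eventually_le_nhds one_pos), eventually_ge_atTop (Real.exp (2 * K))]
    with β e₁ e₂ e₃ hf hW1 hK₂W hK₃W hβK
  obtain ⟨hβ1, hℓeq, -, hδ0, -, -, hx0, -, hp2, hT0, -, -, -, -, hσ0, -⟩ := hf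
  set W := (powScale (2 * s) β + powScale (1 / 2) β) * btLog β ^ 8 with hWdef
  set ε₁ := coreEps1 L β (recordDelta1 L s β) (9 * L * (5 * (powScale (1 / 2) β * btLog β ^ 2)) + btEps β) (r β) with hε₁
  set ε₂ := coreEps2 L β (recordDelta1 L s β) (9 * L * (5 * (powScale (1 / 2) β * btLog β ^ 2)) + btEps β) (r β)
    ((L : ℝ) ^ 3 * (12 * recordDelta1 L s β ^ 4)) with hε₂
  set η := coreEta L β (recordDelta1 L s β) (powScale (1 / 2) β * btLog β ^ 2) (9 * L * (5 * (powScale (1 / 2) β * btLog β ^ 2)) + btEps β) (r β)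
    (btEps β * Fintype.card (Site 3 L)) ((L : ℝ) ^ 3 * (12 * recordDelta1 L s β ^ 4)) with hη
  have hβ0 : 0 ≤ β := by linarith
  have hl0 : 0 ≤ btLog β := zero_le_one.trans (one_le_btLog β)
  have hε1_0 : 0 ≤ ε₁ := coreEps1_nonneg hβ0 hδ0 hT0
  have hε2_0 : 0 ≤ ε₂ := coreEps2_nonneg hβ0 hT0 hσ0
  have hη0 : 0 ≤ η := coreEta_nonneg hβ0 hδ0 (by positivity) hT0 (mul_nonneg (btEps_pos_le β).1.le (Nat.cast_nonneg _)) hσ0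
  have hW0 : 0 ≤ W := by rw [hWdef]; have := powScale_pos (2 * s) β; positivity
  have hη1 : η ≤ 1 := e₃.trans hK₃W
  have hε21 : ε₂ ≤ 1 := e₂.trans hK₂W
  have hk : btKappa L β (recordDelta1 L s β) (powScale (1 / 2) β * btLog β ^ 2) (9 * L * (5 * (powScale (1 / 2) β * btLog β ^ 2)) + btEps β) (r β)
      (btEps β * Fintype.card (Site 3 L)) ((L : ℝ) ^ 3 * (12 * recordDelta1 L s β ^ 4)) ≤ 3 * η + 4 * ε₂ + 3 * (ε₁ + ε₂) ^ 2 := by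
    unfold btKappa; exact kappa_le_of_small hη0 hη1 hε2_0 hε21
  have hpl : (powScale s β * btLog β ^ 4) ^ 2 ≤ W := by
    rw [mul_pow, ← pow_mul, hp2, hWdef]
    exact mul_le_mul_of_nonneg_right (le_add_of_nonneg_right hx0) (by positivity)
  have hWW : W ^ 2 ≤ W := by nlinarith
  have hsq : (ε₁ + ε₂) ^ 2 ≤ 2 * K₁ ^ 2 * W + 2 * K₂ ^ 2 * W := by
    have h := add_le_add e₁ e₂
    have h2 := pow_le_pow_left₀ (add_nonneg hε1_0 hε2_0) h 2
    calc (ε₁ + ε₂) ^ 2 ≤ (K₁ * (powScale s β * btLog β ^ 4) + K₂ * W) ^ 2 := h2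
      _ ≤ 2 * (K₁ * (powScale s β * btLog β ^ 4)) ^ 2 + 2 * (K₂ * W) ^ 2 := by
          have h0 := sq_nonneg (K₁ * (powScale s β * btLog β ^ 4) - K₂ * W)
          have e0 : (K₁ * (powScale s β * btLog β ^ 4) + K₂ * W) ^ 2 + (K₁ * (powScale s β * btLog β ^ 4) - K₂ * W) ^ 2 =
              2 * (K₁ * (powScale s β * btLog β ^ 4)) ^ 2 + 2 * (K₂ * W) ^ 2 := by ring
          linarith
      _ = 2 * K₁ ^ 2 * (powScale s β * btLog β ^ 4) ^ 2 + 2 * K₂ ^ 2 * W ^ 2 := by ring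
      _ ≤ 2 * K₁ ^ 2 * W + 2 * K₂ ^ 2 * W := add_le_add (mul_le_mul_of_nonneg_left hpl (by positivity)) (mul_le_mul_of_nonneg_left hWW (by positivity))
  have hκW : 3 * η + 4 * ε₂ + 3 * (ε₁ + ε₂) ^ 2 ≤ K * W := by
    have e : K * W = 3 * (K₃ * W) + 4 * (K₂ * W) + 3 * (2 * K₁ ^ 2 * W + 2 * K₂ ^ 2 * W) := by rw [hKdef]; ring
    rw [e]; linarith [e₂, e₃, hsq]
  have hxp : powScale (1 / 2) β ≤ powScale (2 * s) β := powScale_le_powScale (by linarith) β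
  have hp0 : 0 ≤ powScale (2 * s) β := (powScale_pos _ _).le
  have hl8 : 0 ≤ btLog β ^ 8 := by positivity
  have hW2 : W ≤ 2 * (powScale (2 * s) β * btLog β ^ 8) := by
    rw [hWdef]
    have h := mul_le_mul_of_nonneg_right (add_le_add_left hxp (powScale (2 * s) β)) hl8
    have e : (powScale (2 * s) β + powScale (2 * s) β) * btLog β ^ 8 = 2 * (powScale (2 * s) β * btLog β ^ 8) := by ring
    rw [e] at h; linarith
  have hℓK : 2 * K ≤ btLog β := by
    rw [hℓeq, ← Real.log_exp (2 * K)]; exact Real.log_le_log (Real.exp_pos _) hβK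
  calc _ ≤ 3 * η + 4 * ε₂ + 3 * (ε₁ + ε₂) ^ 2 := hk
    _ ≤ K * W := hκW
    _ ≤ K * (2 * (powScale (2 * s) β * btLog β ^ 8)) := mul_le_mul_of_nonneg_left hW2 hK0
    _ = 2 * K * (powScale (2 * s) β * btLog β ^ 8) := by ring
    _ ≤ btLog β * (powScale (2 * s) β * btLog β ^ 8) := mul_le_mul_of_nonneg_right hℓK (by positivity)
    _ = powScale (2 * s) β * btLog β ^ 9 := by ring

omit [NeZero L] in
/-- hκ0 for `κ_B = 2β^{-2s}ℓ⁹`. [folklore] -/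
theorem rateB_nonneg (s β : ℝ) : 0 ≤ 2 * (powScale (2 * s) β * btLog β ^ 9) :=
  mul_nonneg (by norm_num) (mul_nonneg (powScale_pos _ _).le (pow_nonneg (zero_le_one.trans (one_le_btLog β)) 9))

/-- ★ `btKappa(schedule B) + β^{-1} ≤ κ_B` eventually (`0 < s ≤ 1/4`). [folklore] -/
theorem rateB_ge {s : ℝ} (hs : 0 < s) (hs4 : s ≤ 1 / 4) {r : ℝ → ℝ} (hr : ∀ β, 0 ≤ r β ∧ r β ≤ powScale (1 / 2) β * btLog β) :
    ∀ᶠ β : ℝ in atTop,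
      btKappa L β (recordDelta1 L s β) (powScale (1 / 2) β * btLog β ^ 2) (9 * L * (5 * (powScale (1 / 2) β * btLog β ^ 2)) + btEps β) (r β)
          (btEps β * Fintype.card (Site 3 L)) ((L : ℝ) ^ 3 * (12 * recordDelta1 L s β ^ 4)) + powScale 1 β ≤ 2 * (powScale (2 * s) β * btLog β ^ 9) := by
  filter_upwards [eventually_btKappa_le_B (L := L) hs hs4 hr] with β hκ
  have hl9 : 1 ≤ btLog β ^ 9 := one_le_pow₀ (one_le_btLog β)
  have hp0 : 0 ≤ powScale (2 * s) β := (powScale_pos _ _).le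
  have hA : powScale 1 β ≤ powScale (2 * s) β * btLog β ^ 9 :=
    (powScale_le_powScale (show 2 * s ≤ 1 by linarith) β).trans (le_mul_of_one_le_right hp0 hl9)
  linarith

/-- ★ hκ_dom for `κ_B`: `C·(43β^{-s})² ≤ κ_B` eventually, every real `C`. [folklore] -/
theorem rateB_dom (s C : ℝ) : ∀ᶠ β : ℝ in atTop, C * (43 * powScale s β) ^ 2 ≤ 2 * (powScale (2 * s) β * btLog β ^ 9) := by
  filter_upwards [eventually_ge_atTop (1 : ℝ), eventually_ge_atTop (Real.exp (1849 * |C|)), eventually_btLog_eq] with β hβ1 hβC hℓ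
  have hβ0 : 0 ≤ β := by linarith
  have hp2 : powScale s β ^ 2 = powScale (2 * s) β := by
    rw [powScale_eq hβ1, powScale_eq hβ1, ← Real.rpow_mul_natCast hβ0]; congr 1; push_cast; ring
  have hℓC : 1849 * |C| ≤ btLog β := by rw [hℓ, ← Real.log_exp (1849 * |C|)]; exact Real.log_le_log (Real.exp_pos _) hβC
  have hl9 : btLog β ≤ btLog β ^ 9 := le_self_pow₀ (one_le_btLog β) (by norm_num)
  have hp0 : 0 ≤ powScale s β ^ 2 := sq_nonneg _
  rw [← hp2]
  calc C * (43 * powScale s β) ^ 2 = 1849 * C * powScale s β ^ 2 := by ring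
    _ ≤ 1849 * |C| * powScale s β ^ 2 := by gcongr; exact le_abs_self C
    _ ≤ btLog β ^ 9 * powScale s β ^ 2 := mul_le_mul_of_nonneg_right (hℓC.trans hl9) hp0
    _ ≤ _ := by
        have h0 : 0 ≤ powScale s β ^ 2 * btLog β ^ 9 := mul_nonneg hp0 (pow_nonneg (zero_le_one.trans (one_le_btLog β)) 9)
        linarith

/-- ★ hκ_small for `κ_B`: `κ_B ≤ a·λ_b(L³β)` eventually for every `a > 0` (`1/6 < s`). [folklore] -/
theorem rateB_small {s : ℝ} (hs6 : 1 / 6 < s) (a : ℝ) (ha : 0 < a) :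
    ∀ᶠ β : ℝ in atTop, 2 * (powScale (2 * s) β * btLog β ^ 9) ≤ a * bareLambda ((L : ℝ) ^ 3 * β) := by
  have hL0 : (0 : ℝ) < L := by exact_mod_cast NeZero.pos L
  set cL : ℝ := (2 / (L : ℝ) ^ 3) ^ ((1 : ℝ) / 3) with hcL
  have hcL0 : 0 < cL := by rw [hcL]; positivity
  have t := tendsto_powScale_mul_btLog_pow (show (0 : ℝ) < 2 * s - 1 / 3 by linarith) 9
  filter_upwards [t.eventually (eventually_le_nhds (show (0 : ℝ) < a * cL / 2 by positivity)), eventually_ge_atTop (1 : ℝ)] with β hsm hβ1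
  have hβ0 : 0 < β := by linarith
  have hsplit : powScale (2 * s) β = powScale (2 * s - 1 / 3) β * β ^ (-(1 : ℝ) / 3) := by
    rw [powScale_eq hβ1, powScale_eq hβ1, ← Real.rpow_add hβ0]; congr 1; ring
  have hb3 : 0 ≤ β ^ (-(1 : ℝ) / 3) := (Real.rpow_pos_of_pos hβ0 _).le
  rw [bareLambda_cube_eq (L := L) hβ0, ← hcL]
  calc 2 * (powScale (2 * s) β * btLog β ^ 9) = 2 * (powScale (2 * s - 1 / 3) β * btLog β ^ 9) * β ^ (-(1 : ℝ) / 3) := by rw [hsplit]; ring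
    _ ≤ 2 * (a * cL / 2) * β ^ (-(1 : ℝ) / 3) := mul_le_mul_of_nonneg_right (mul_le_mul_of_nonneg_left hsm (by norm_num)) hb3
    _ = a * (cL * β ^ (-(1 : ℝ) / 3)) := by ring

/-! ## §5 hr_small for any radius `r ≤ β^{-1/2}ℓ` -/

/-- ★ hr_small on schedule B: `12|Site|·r β < β^{-s}` eventually for every `0 ≤ r ≤ β^{-1/2}ℓ` (`s < 1/2`). [folklore] -/
theorem eventually_radius_small_B {s : ℝ} (hs2 : s < 1 / 2) {r : ℝ → ℝ} (hr : ∀ β, 0 ≤ r β ∧ r β ≤ powScale (1 / 2) β * btLog β) :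
    ∀ᶠ β : ℝ in atTop, 12 * Fintype.card (Site 3 L) * r β < powScale s β := by
  have hN : (0 : ℝ) < Fintype.card (Site 3 L) := by exact_mod_cast Fintype.card_pos
  have hs2' : (0 : ℝ) < 1 / 2 - s := by linarith
  have t := tendsto_powScale_mul_btLog_pow hs2' 1
  filter_upwards [eventually_ge_atTop (1 : ℝ), t.eventually (eventually_lt_nhds (show (0 : ℝ) < 1 / (12 * Fintype.card (Site 3 L)) by positivity))]
    with β hβ1 hrat
  rw [pow_one] at hrat
  have e : powScale (1 / 2) β = powScale (1 / 2 - s) β * powScale s β := by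
    rw [powScale_eq hβ1, powScale_eq hβ1, powScale_eq hβ1, ← Real.rpow_add (by linarith)]; ring_nf
  have hp : 0 < powScale s β := powScale_pos _ _
  have hl0 : 0 ≤ btLog β := zero_le_one.trans (one_le_btLog β)
  have h1 : 12 * Fintype.card (Site 3 L) * (powScale (1 / 2 - s) β * btLog β) < 1 := by
    have := mul_lt_mul_of_pos_left hrat (show (0 : ℝ) < 12 * Fintype.card (Site 3 L) by positivity)
    rwa [show 12 * (Fintype.card (Site 3 L) : ℝ) * (1 / (12 * Fintype.card (Site 3 L))) = 1 by field_simp] at this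
  calc 12 * Fintype.card (Site 3 L) * r β ≤ 12 * Fintype.card (Site 3 L) * (powScale (1 / 2) β * btLog β) :=
        mul_le_mul_of_nonneg_left (hr β).2 (by positivity)
    _ = 12 * Fintype.card (Site 3 L) * (powScale (1 / 2 - s) β * btLog β) * powScale s β := by rw [e]; ring
    _ < 1 * powScale s β := mul_lt_mul_of_pos_right h1 hp
    _ = powScale s β := one_mul _

end Summit.QuantumFields.YangMills.Theorems.FemtoTransferGap.TwoLattice.ConstTube

end
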